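import Literature.NumberTheory.EllipticCurves.DivisionField
import Literature.NumberTheory.EllipticCurves.SemistableModPImageIrreducibleProofs
import HarnessLib

/-!
# Route `AdditiveBranchIMC` (rung K1), crux `GordTwoRankOne` (item 19358), small-image rows — Serre 1972 §2.4
# Prop. 15 for the `p`-division field: «`E[p]` irreducible and `ρ̄_{E,p}` not onto ⟹ `p ∤ #Gal(ℚ(E[p])/ℚ)`»
# (cell `bsd-addord`, seat w2-acc5 gen 8 on the planner's re-point; `--supports 19358`, helper)

HONEST FRAMING.  THEOREMS ONLY (no definition, no named fact, no instance, no `sorry`); nothing is booked; the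
crux stays OPEN; «BSD is not proved by any of this».  Everything here is PROVED: the group theory is the TREE's
Serre 1972 Prop. 15 development (`Serre1972.eq_top_or_borel_of_dvd_card` in `SerreOpenImageGroupLemmas`, framed
for `ρ̄_{E,p}` over `ℚ` by `exists_frame_galoisRepTorsion_rat` / `SerreOpenImageDeterminantProofs` — `det ρ̄ = χ̄_p`
from the Weil pairing, onto `𝔽_pˣ` — and assembled as
`WeierstrassCurve.not_dvd_card_of_not_hasSurjectiveModNGaloisRep`, `SemistableModPImageIrreducibleProofs`).

WHAT.  k1-c3x gen 2's Part 16 (`AdditiveBranchIMCGordTwoRankOneHeegnerKolyvaginSmallImageClassNumber`, p547579)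
feeds Deo–Ray–Sujatha 2023 Thm 3.9 with the per-twist certificate clause
(i) `¬ p ∣ Nat.card (Wd.divisionField p ≃ₐ[ℚ] Wd.divisionField p)` — "in substance automatic on the small-image
rows", kept displayed because the seat found no image-size lemma for `#Gal(ℚ(E[p])/ℚ)` (k1-c3x WANTED, STATUS
2026-08-27T16:25:47Z; planner g24 re-point 16:28:44Z (3)).  The image-size statement `p ∤ #ρ̄_{E,p}(Γ_ℚ)` IS in
the tree (bsd-smallim / b2b lineages: `not_dvd_card_of_not_hasSurjectiveModNGaloisRep`, and frame-free
`Rank1Residual.not_dvd_card_range_galoisRepTorsion_of_irreducible_of_not_surjective` in the K6 file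
`SmallImageMuTransferMuTransferX9TopGenerator`); what was missing is the passage to the DIVISION FIELD.  THIS FILE:

* `galoisRepTorsion_eq_one_iff_forall` — `ρ̄(τ) = 1 ↔ τ` fixes `E[p]` pointwise (local copy, light cone);
* `absRestrictNormalHom_surjective_of_normal` — `Γ_K → Gal(L/K)` onto (generic `K`, no `ℚ`-algebra diamond);
* ★ `natCard_aut_divisionField_eq` — **`#Gal(ℚ(E[p])/ℚ) = #ρ̄_{E,p}(Γ_ℚ)`** (both are `Γ_ℚ ⧸ Γ_{ℚ(E[p])}`:
  `DivisionField.absRestrictNormalHom_divisionField_eq_one_iff`);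
* ★ `not_dvd_card_aut_divisionField` — **hypothesis (i) of p547579**:
  `W.HasIrreducibleModPGaloisRep p → ¬ W.HasSurjectiveModNGaloisRep p → ¬ p ∣ Nat.card (W.divisionField p ≃ₐ[ℚ] _)`
  (the tree's framed Prop. 15, transported by `card_map_range_galoisRepTorsion`, then ★).

USE: the hypothesis is ¬surj at level `p` (not `pⁿ`): a 3-adically defective row that is onto mod `3` has
`3 ∣ #GL₂(𝔽₃) = #Gal(ℚ(E[3])/ℚ)`, so clause (i) fails there; the passage from the row's `W` to its twist `Wd`
(`p` odd) is not in this file.  An independent explicit-word matrix proof of the generation half of Prop. 15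
landed as `Literature/GroupTheory/DicksonGLTwoTransvections` (p550087) before the tree's copy was found; it is
not used here.

References: Serre, Invent. Math. 15 (1972) §2.4 Prop. 15, §5.4 [Serre1972]; Serre, *Abelian ℓ-adic representations*
(1968) IV.1.1–1.2 [SerreAbelianLadic1968]; Deo–Ray–Sujatha (2023) Thm. 3.9, Lemma 5.1 [DeoRaySujatha2023].
-/

set_option autoImplicit false
set_option linter.dupNamespace false
noncomputable section

open scoped Classical
open Field WeierstrassCurve
  Literature.NumberTheory.EllipticCurves Literature.NumberTheory.GaloisRepresentations

namespace Summit.BirchSwinnertonDyer.BirchSwinnertonDyer.Theorems.AdditiveBranchIMCGordTwoRankOne.SmallImageDickson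

variable (W : WeierstrassCurve ℚ) [W.IsElliptic] (p : ℕ) [hp : Fact p.Prime]

omit [W.IsElliptic] hp in
/-- `ρ̄_{E,p}(τ) = 1` iff `τ` fixes `E[p]` pointwise (local copy of the tree's
`galoisRepTorsion_eq_one_iff'`, kept to keep the import cone light). [folklore] -/
theorem galoisRepTorsion_eq_one_iff_forall (τ : absoluteGaloisGroup ℚ) :
    galoisRepTorsion W p τ = 1 ↔ ∀ T : geomTorsion W p, τ • T = T := by
  refine ⟨fun h T ↦ ?_, fun h ↦ ?_⟩
  · have h1 := congrArg (fun g : Multiplicative (AddAut (geomTorsion W p)) ↦ (Multiplicative.toAdd g) T) h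
    simpa only [galoisRepTorsion_apply, toAdd_one, AddAut.zero_apply] using h1
  · apply Multiplicative.toAdd.injective
    ext T
    rw [show (Multiplicative.toAdd (galoisRepTorsion W p τ)) T = τ • T from galoisRepTorsion_apply W p τ T,
      h T, toAdd_one, AddAut.zero_apply]

/-- Restriction `Γ_K → Gal(L/K)` is onto for a normal subextension `L` of `K̄/K` (generic `K`, so that no
`ℚ`-algebra diamond on `K̄` arises; twin of `GlobalArtinMapOfCharactersProofs.absRestrictNormalHom_surjective`,
not imported to keep this file's cone light). [folklore] -/
theorem absRestrictNormalHom_surjective_of_normal {K : Type*} [Field K]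
    (L : IntermediateField K (AlgebraicClosure K)) [Normal K L] :
    Function.Surjective (absRestrictNormalHom L) :=
  (AlgEquiv.restrictNormalHom_surjective (F := K) (K₁ := L) (AlgebraicClosure K)).comp
    (absoluteGaloisGroup.toAlgEquiv K).surjective

omit hp in
/-- ★ **`#Gal(ℚ(E[p])/ℚ) = #ρ̄_{E,p}(Γ_ℚ)`**: restriction `Γ_ℚ → Gal(ℚ(E[p])/ℚ)` is onto with kernel
`Γ_{ℚ(E[p])}` (`absRestrictNormalHom_divisionField_eq_one_iff`), which is also the kernel of `ρ̄_{E,p}`; both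
groups are `Γ_ℚ ⧸ Γ_{ℚ(E[p])}`. [cite: SerreAbelianLadic1968, IV.1.1–1.2] -/
theorem natCard_aut_divisionField_eq [NeZero p] :
    Nat.card (W.divisionField p ≃ₐ[ℚ] W.divisionField p) = Nat.card (galoisRepTorsion W p).range := by
  haveI : IsGalois ℚ (W.divisionField p) := W.isGalois_divisionField p
  have hsurj : Function.Surjective (absRestrictNormalHom (W.divisionField p)) :=
    absRestrictNormalHom_surjective_of_normal (W.divisionField p)
  have hker : (absRestrictNormalHom (W.divisionField p)).ker = (galoisRepTorsion W p).ker := by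
    ext σ
    rw [MonoidHom.mem_ker, MonoidHom.mem_ker, W.absRestrictNormalHom_divisionField_eq_one_iff p σ,
      galoisRepTorsion_eq_one_iff_forall]
  calc Nat.card (W.divisionField p ≃ₐ[ℚ] W.divisionField p)
      = Nat.card (absoluteGaloisGroup ℚ ⧸ (absRestrictNormalHom (W.divisionField p)).ker) :=
        Nat.card_congr (QuotientGroup.quotientKerEquivOfSurjective _ hsurj).toEquiv.symm
    _ = Nat.card (absoluteGaloisGroup ℚ ⧸ (galoisRepTorsion W p).ker) :=
        Nat.card_congr (QuotientGroup.quotientMulEquivOfEq hker).toEquiv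
    _ = Nat.card (galoisRepTorsion W p).range :=
        Nat.card_congr (QuotientGroup.quotientKerEquivRange _).toEquiv

/-- ★ **Hypothesis (i) of k1-c3x's p547579 on the small-image rows**: for an elliptic curve `W/ℚ` and a
prime `p` with `E[p]` irreducible and `ρ̄_{E,p}` NOT surjective, `p ∤ #Gal(ℚ(E[p])/ℚ)` — Serre 1972 §2.4
Prop. 15 (an irreducible subgroup of `GL₂(𝔽_p)` of order divisible by `p` contains `SL₂(𝔽_p)`) with
`det ρ̄ = χ̄_p` onto `𝔽_pˣ`, as the TREE's framed theorem `not_dvd_card_of_not_hasSurjectiveModNGaloisRep` in the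
frame `exists_frame_galoisRepTorsion_rat`, transported by `card_map_range_galoisRepTorsion` and
`natCard_aut_divisionField_eq`.  PROVED, no cite input. [cite: Serre1972, §2.4 Prop. 15; §5.4, proof of Prop. 21]
[cite: DeoRaySujatha2023, §5 Lemma 5.1] -/
theorem not_dvd_card_aut_divisionField [NeZero p] (hirr : W.HasIrreducibleModPGaloisRep p)
    (hns : ¬ W.HasSurjectiveModNGaloisRep p) :
    ¬ p ∣ Nat.card (W.divisionField p ≃ₐ[ℚ] W.divisionField p) := by
  obtain ⟨e, Φ, he, -⟩ := exists_frame_galoisRepTorsion_rat W p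
  rw [natCard_aut_divisionField_eq, ← card_map_range_galoisRepTorsion W p Φ]
  exact not_dvd_card_of_not_hasSurjectiveModNGaloisRep W p Φ e he hirr hns

end Summit.BirchSwinnertonDyer.BirchSwinnertonDyer.Theorems.AdditiveBranchIMCGordTwoRankOne.SmallImageDickson

end
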